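import Mathlib
import HarnessLib
import Summits.CriticalPhenomena.PercolationContinuityZ3.Theorems.PercLowPointHalfSpaceBoundaryTwoArmDecayStubCensusRootTransport

/-!
# Crux `PercLowPointHalfSpace.BoundaryTwoArmDecay` (stmt-CriticalPhenomena-0911), line
# `staircase-bootstrap-floor-decoupling` — stub `stub_census` (the TRUNCATED LEVEL CENSUS), part V: assembly

Proves EXACTLY the registered stub `stub_census` of the skeleton
`Cruxes/BoundaryTwoArmDecay/Lines/staircase_bootstrap_floor_decoupling.lean` (lead
prover-line-stmt-CriticalPhenomena-0911-a5-0); lands with `--supports stmt-CriticalPhenomena-0911`. Definition-free;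
the objects are those of `PercLowPointHalfSpaceBoundaryTwoArmDecayStubCensusDefs.lean`.

## Statement

At `p_c = p_c(ℤ³)`, with `ℍ = {0 ≤ x₀}`, `U = C_ℍ(0)`, `e = (0,1,0)`, `A_n = {U n-tall, C_ℍ(e) n-tall, 0 ↮_ℍ e}`,
`K_n` the number of partner-kiss edges of `U` (floor edges `(q₁,q₂)`, `q₁ ∈ U ∌ q₂`, `C_ℍ(q₂)` n-tall) and
`e_n = E[1{height U = n}/|U ∩ ∂ℍ|]`:  `P(A_n ∩ {K_n ≤ k}) ≤ C·k·e_n` for all `n, k` (`C = 2/p_c³`).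

## Proof (files `…StubCensusDefs/Transport/Levels/Staple/RootTransport.lean`)

With `V = C_{ℍ₋₁}(0) ⊇ U`, `J` = number of `n`-tall `ℍ`-clusters inside `V`, `ν_n = E[1{U n-tall}/|U ∩ ∂ℍ|]`,
`κ_n = E[1{U n-tall, K_n ≥ 1}/|U ∩ ∂ℍ|]`, `X_n = E[1{U n-tall, J ≥ 2, V footed at level -1}/|U ∩ ∂ℍ|]`,
`Y_n = E[1{U n-tall, V footed} J⁻¹/|U ∩ ∂ℍ|]`:
* ROOT TRANSPORT (`stub_census_rootTransport`): `P(A_n ∩ {K_n ≤ k}) ≤ k κ_n`;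
* STAPLE (`kap_le_X`, insertion tolerance under the selected kiss edge): `p_c³ κ_n ≤ X_n`;
* LEVEL CENSUS (this file): pointwise `1{J ≥ 2} + 2 J⁻¹ ≤ 2` for `J ≥ 1`, so `X_n + 2 Y_n ≤ 2 ν_n` (`X_add_le`);
  the two-anchor transport and vertical stationarity give `ν_{n+1} ≤ Y_n` (`nu_succ_le_Y`); and `ν_n = e_n + ν_{n+1}`
  (`nu_eq`), `ν_n ≤ 1`; hence `X_n ≤ 2 e_n` (`X_le_two_eD`) and `P(A_n ∩ {K_n ≤ k}) ≤ 2 k e_n / p_c³`.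

Sources: R. Lyons – Y. Peres (2016) §8.2 (mass transport); G. Grimmett, *Percolation* (1999), Thm. (7.35) (BGN),
§1.4 (`0 < p_c < 1`); B. Bollobás – O. Riordan (2006) Ch. 5 (insertion tolerance).
-/

noncomputable section

namespace Summit.CriticalPhenomena.PercolationContinuityZ3.Theorems.BoundaryTwoArmDecay

open MeasureTheory Filter Topology
open Literature.Probability.Percolation Literature.Probability.LatticeModels
open scoped ENNReal

namespace StubCensus

open LowPoint (conn_symm conn_trans conn_refl conn_mono conn_iff_mem_cluster lintegral_shift)
open Negative (μ)

/-! ### Measurability of the census integrands -/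

/-- The integrand of `ν_n` is measurable. -/
theorem measurable_nuIntegrand (n : ℕ) : Measurable fun ω : BondConfig (Site 3) =>
    (tall (halfSpace 3) n 0).indicator (fun ω => (((fl (halfSpace 3) 0 0 ω : ℕ∞) : ℝ≥0∞))⁻¹) ω :=
  (measurable_fl_inv _ _ _).indicator (measurableSet_tall _ _ _)

/-- The integrand of `X_n` is measurable. -/
theorem measurable_X (n : ℕ) : Measurable fun ω : BondConfig (Site 3) =>
    {ω : BondConfig (Site 3) | ω ∈ tall (halfSpace 3) n 0 ∧ 2 ≤ J n 0 ω ∧ 0 < fl Hm (-1) 0 ω}.indicator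
      (fun ω => (((fl (halfSpace 3) 0 0 ω : ℕ∞) : ℝ≥0∞))⁻¹) ω := by
  have hset : {ω : BondConfig (Site 3) | ω ∈ tall (halfSpace 3) n 0 ∧ 2 ≤ J n 0 ω ∧ 0 < fl Hm (-1) 0 ω} =
      tall (halfSpace 3) n 0 ∩ ({ω | 2 ≤ J n 0 ω} ∩ {ω | 0 < fl Hm (-1) 0 ω}) := Set.ext fun _ => Iff.rfl
  rw [hset]
  exact (measurable_fl_inv _ _ _).indicator ((measurableSet_tall _ _ _).inter
    (((measurable_J n 0) measurableSet_Ici).inter ((measurable_fl Hm (-1) 0) (MeasurableSet.of_discrete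
      (s := Set.Ioi (0 : ℕ∞))))))

/-- The integrand of `Y_n` is measurable. -/
theorem measurable_Y (n : ℕ) : Measurable fun ω : BondConfig (Site 3) =>
    (tall (halfSpace 3) n 0).indicator (fun ω => (J n 0 ω)⁻¹ *
      ((((fl (halfSpace 3) 0 0 ω : ℕ∞) : ℝ≥0∞))⁻¹ * ((((fl Hm (-1) 0 ω : ℕ∞) : ℝ≥0∞))⁻¹ *
        ((fl Hm (-1) 0 ω : ℕ∞) : ℝ≥0∞)))) ω :=
  ((measurable_J n 0).inv.mul ((measurable_fl_inv _ _ _).mul ((measurable_fl_inv _ _ _).mul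
    ((Measurable.of_discrete (f := fun m : ℕ∞ => (m : ℝ≥0∞))).comp (measurable_fl _ _ _))))).indicator
    (measurableSet_tall _ _ _)

/-! ### The level census: `X_n ≤ 2 e_n` -/

/-- The arithmetic of the census at one configuration: with `j ≥ 1` sub-clusters, `1{j ≥ 2} ≤ 2(1 - 1/j)`. -/
theorem pointwise_census {j c x y : ℝ≥0∞} (hj : 1 ≤ j) (hx : x ≤ if 2 ≤ j then c else 0) (hy : y ≤ j⁻¹ * c) :
    x + 2 * y ≤ 2 * c := by
  by_cases h2 : 2 ≤ j
  · rw [if_pos h2] at hx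
    have hinv : j⁻¹ ≤ 2⁻¹ := ENNReal.inv_le_inv.2 h2
    calc x + 2 * y ≤ c + 2 * (2⁻¹ * c) := add_le_add hx (mul_le_mul' le_rfl (hy.trans (mul_le_mul' hinv le_rfl)))
      _ = 2 * c := by
        rw [← mul_assoc, ENNReal.mul_inv_cancel two_ne_zero ENNReal.ofNat_ne_top, one_mul, two_mul]
  · rw [if_neg h2] at hx
    have hx0 : x = 0 := le_antisymm hx bot_le
    have hinv : j⁻¹ ≤ 1 := ENNReal.inv_le_one.2 hj
    rw [hx0, zero_add]
    calc 2 * y ≤ 2 * (1 * c) := mul_le_mul' le_rfl (hy.trans (mul_le_mul' hinv le_rfl))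
      _ = 2 * c := by rw [one_mul]

/-- **The census inequality `X_n + 2 Y_n ≤ 2 ν_n`** (pointwise on the good event, using `J ≥ 1` on `{U n-tall}`). -/
theorem X_add_le (n : ℕ) :
    (∫⁻ ω, {ω : BondConfig (Site 3) | ω ∈ tall (halfSpace 3) n 0 ∧ 2 ≤ J n 0 ω ∧ 0 < fl Hm (-1) 0 ω}.indicator
        (fun ω => (((fl (halfSpace 3) 0 0 ω : ℕ∞) : ℝ≥0∞))⁻¹) ω ∂μ) +
      2 * ∫⁻ ω, (tall (halfSpace 3) n 0).indicator (fun ω => (J n 0 ω)⁻¹ *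
        ((((fl (halfSpace 3) 0 0 ω : ℕ∞) : ℝ≥0∞))⁻¹ * ((((fl Hm (-1) 0 ω : ℕ∞) : ℝ≥0∞))⁻¹ *
          ((fl Hm (-1) 0 ω : ℕ∞) : ℝ≥0∞)))) ω ∂μ ≤ 2 * nu n := by
  rw [← lintegral_const_mul 2 (measurable_Y n), ← lintegral_add_left (measurable_X n), nu,
    ← lintegral_const_mul 2 (measurable_nuIntegrand n)]
  refine lintegral_mono_ae ?_
  filter_upwards [ae_good] with ω hω
  by_cases ht : ω ∈ tall (halfSpace 3) n 0
  · simp only [Set.indicator_of_mem ht]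
    refine pointwise_census (one_le_J hω.2 ht) ?_ ?_
    · by_cases hx : ω ∈ {ω : BondConfig (Site 3) | ω ∈ tall (halfSpace 3) n 0 ∧ 2 ≤ J n 0 ω ∧ 0 < fl Hm (-1) 0 ω}
      · rw [Set.indicator_of_mem hx, if_pos hx.2.1]
      · rw [Set.indicator_of_notMem hx]
        exact bot_le
    · calc (J n 0 ω)⁻¹ * ((((fl (halfSpace 3) 0 0 ω : ℕ∞) : ℝ≥0∞))⁻¹ * ((((fl Hm (-1) 0 ω : ℕ∞) : ℝ≥0∞))⁻¹ *
            ((fl Hm (-1) 0 ω : ℕ∞) : ℝ≥0∞)))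
          ≤ (J n 0 ω)⁻¹ * ((((fl (halfSpace 3) 0 0 ω : ℕ∞) : ℝ≥0∞))⁻¹ * 1) := by
            gcongr
            exact ENNReal.inv_mul_le_one _
        _ = _ := by rw [mul_one]
  · rw [Set.indicator_of_notMem (show ω ∉ {ω : BondConfig (Site 3) | ω ∈ tall (halfSpace 3) n 0 ∧ 2 ≤ J n 0 ω ∧
      0 < fl Hm (-1) 0 ω} from fun h => ht h.1)]
    simp only [Set.indicator_of_notMem ht, mul_zero, zero_add]
    exact le_rfl

/-- `ν_n ≤ 1`. -/
theorem nu_le_one (n : ℕ) : nu n ≤ 1 := by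
  rw [nu]
  calc ∫⁻ ω, (tall (halfSpace 3) n 0).indicator (fun ω => (((fl (halfSpace 3) 0 0 ω : ℕ∞) : ℝ≥0∞))⁻¹) ω ∂μ
      ≤ ∫⁻ _, 1 ∂μ := by
        refine lintegral_mono fun ω => ?_
        by_cases ht : ω ∈ tall (halfSpace 3) n 0
        · rw [Set.indicator_of_mem ht]
          exact ENNReal.inv_le_one.2 (one_le_fl rfl ω)
        · rw [Set.indicator_of_notMem ht]
          exact bot_le
    _ = 1 := by rw [lintegral_const, measure_univ, mul_one]

/-- `ν_n < ∞`. -/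
theorem nu_ne_top (n : ℕ) : nu n ≠ ⊤ := ne_top_of_le_ne_top ENNReal.one_ne_top (nu_le_one n)

/-- **The split of the tall density**: `ν_n = e_n + ν_{n+1}` (an `n`-tall cluster has exact height `n` or is
`(n+1)`-tall). -/
theorem nu_eq (n : ℕ) : nu n = eD n + nu (n + 1) := by
  have hmeas : Measurable fun ω : BondConfig (Site 3) =>
      {ω | (∃ y : Site 3, (n : ℤ) ≤ y 0 ∧ ω ∈ openConnIn (halfSpace 3) 0 y) ∧
        ¬ (∃ y : Site 3, ((n + 1 : ℕ) : ℤ) ≤ y 0 ∧ ω ∈ openConnIn (halfSpace 3) 0 y)}.indicator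
      (fun ω => (((halfSpaceFootprint ω : ℕ∞) : ENNReal))⁻¹) ω := by
    change Measurable fun ω : BondConfig (Site 3) => (tall (halfSpace 3) n 0 ∩ (tall (halfSpace 3) (n + 1) 0)ᶜ).indicator
      (fun ω => (((fl (halfSpace 3) 0 0 ω : ℕ∞) : ℝ≥0∞))⁻¹) ω
    exact (measurable_fl_inv _ _ _).indicator ((measurableSet_tall _ _ _).inter (measurableSet_tall _ _ _).compl)
  rw [nu, nu, eD, ← lintegral_add_left hmeas]
  refine lintegral_congr fun ω => ?_
  by_cases h1 : ω ∈ tall (halfSpace 3) (n + 1) 0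
  · have h0 : ω ∈ tall (halfSpace 3) n 0 := tall_mono h1 (Nat.le_succ n)
    rw [Set.indicator_of_mem h0, Set.indicator_of_mem h1, Set.indicator_of_notMem (show ω ∉ {ω |
      (∃ y : Site 3, (n : ℤ) ≤ y 0 ∧ ω ∈ openConnIn (halfSpace 3) 0 y) ∧
      ¬ (∃ y : Site 3, ((n + 1 : ℕ) : ℤ) ≤ y 0 ∧ ω ∈ openConnIn (halfSpace 3) 0 y)} from fun h => h.2 h1), zero_add]
  · by_cases h0 : ω ∈ tall (halfSpace 3) n 0
    · rw [Set.indicator_of_mem h0, Set.indicator_of_notMem h1, Set.indicator_of_mem (show ω ∈ {ω |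
        (∃ y : Site 3, (n : ℤ) ≤ y 0 ∧ ω ∈ openConnIn (halfSpace 3) 0 y) ∧
        ¬ (∃ y : Site 3, ((n + 1 : ℕ) : ℤ) ≤ y 0 ∧ ω ∈ openConnIn (halfSpace 3) 0 y)} from ⟨h0, h1⟩), add_zero]
      rfl
    · rw [Set.indicator_of_notMem h0, Set.indicator_of_notMem h1, Set.indicator_of_notMem (show ω ∉ {ω |
        (∃ y : Site 3, (n : ℤ) ≤ y 0 ∧ ω ∈ openConnIn (halfSpace 3) 0 y) ∧
        ¬ (∃ y : Site 3, ((n + 1 : ℕ) : ℤ) ≤ y 0 ∧ ω ∈ openConnIn (halfSpace 3) 0 y)} from fun h => h0 h.1), add_zero]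

/-- `e_n < ∞`. -/
theorem eD_ne_top (n : ℕ) : eD n ≠ ⊤ :=
  ne_top_of_le_ne_top (nu_ne_top n) (by rw [nu_eq n]; exact le_self_add)

/-- **The level census**: `X_n ≤ 2 e_n` — from `X_n + 2 Y_n ≤ 2 ν_n`, `ν_{n+1} ≤ Y_n` (`nu_succ_le_Y`) and
`ν_n = e_n + ν_{n+1}`. -/
theorem X_le_two_eD (n : ℕ) :
    ∫⁻ ω, {ω : BondConfig (Site 3) | ω ∈ tall (halfSpace 3) n 0 ∧ 2 ≤ J n 0 ω ∧ 0 < fl Hm (-1) 0 ω}.indicator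
        (fun ω => (((fl (halfSpace 3) 0 0 ω : ℕ∞) : ℝ≥0∞))⁻¹) ω ∂μ ≤ 2 * eD n := by
  have h3 : (∫⁻ ω, {ω : BondConfig (Site 3) | ω ∈ tall (halfSpace 3) n 0 ∧ 2 ≤ J n 0 ω ∧ 0 < fl Hm (-1) 0 ω}.indicator
        (fun ω => (((fl (halfSpace 3) 0 0 ω : ℕ∞) : ℝ≥0∞))⁻¹) ω ∂μ) + 2 * nu (n + 1) ≤ 2 * eD n + 2 * nu (n + 1) :=
    calc _ ≤ _ := add_le_add le_rfl (mul_le_mul' le_rfl (nu_succ_le_Y n))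
      _ ≤ 2 * nu n := X_add_le n
      _ = 2 * eD n + 2 * nu (n + 1) := by rw [nu_eq, mul_add]
  exact (ENNReal.add_le_add_iff_right (ENNReal.mul_ne_top ENNReal.ofNat_ne_top (nu_ne_top _))).1 h3

/-! ### Assembly -/

/-- **The census in `ℝ≥0∞`**: `P(A_n ∩ {K_n ≤ k}) ≤ 2 k e_n / p_c³`. -/
theorem census_ennreal (n k : ℕ) :
    μ ({ω | (∃ y : Site 3, (n : ℤ) ≤ y 0 ∧ ω ∈ openConnIn (halfSpace 3) 0 y) ∧
            (∃ y : Site 3, (n : ℤ) ≤ y 0 ∧ ω ∈ openConnIn (halfSpace 3) ((0 : Site 3) + Pi.single 1 1) y) ∧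
            ω ∉ openConnIn (halfSpace 3) 0 ((0 : Site 3) + Pi.single 1 1)} ∩
          {ω | {q : Site 3 × Site 3 | q.1 0 = 0 ∧ q.2 0 = 0 ∧ (zdGraph 3).Adj q.1 q.2 ∧
              ω ∈ openConnIn (halfSpace 3) 0 q.1 ∧ ω ∉ openConnIn (halfSpace 3) 0 q.2 ∧
              ∃ y : Site 3, (n : ℤ) ≤ y 0 ∧ ω ∈ openConnIn (halfSpace 3) q.2 y}.ncard ≤ k}) ≤
      (2 * k * eD n) / ENNReal.ofReal ((criticalProbI 3 : ℝ) ^ 3) := by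
  have hp : 0 < (criticalProbI 3 : ℝ) := by
    rw [coe_criticalProbI]
    exact (Grimmett1999_criticalProb_pos_lt_one_holds 3 (by norm_num)).1
  have hP3 : ENNReal.ofReal ((criticalProbI 3 : ℝ) ^ 3) ≠ 0 := (ENNReal.ofReal_pos.2 (pow_pos hp 3)).ne'
  rw [ENNReal.le_div_iff_mul_le (Or.inl hP3) (Or.inl ENNReal.ofReal_ne_top)]
  calc _ ≤ (k * kap n) * ENNReal.ofReal ((criticalProbI 3 : ℝ) ^ 3) :=
        mul_le_mul' (stub_census_rootTransport n k) le_rfl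
    _ = k * (ENNReal.ofReal ((criticalProbI 3 : ℝ) ^ 3) * kap n) := by ring
    _ ≤ k * (2 * eD n) := mul_le_mul' le_rfl ((kap_le_X n).trans (X_le_two_eD n))
    _ = 2 * k * eD n := by ring

/-- **The census** (real form): `P(A_n ∩ {K_n ≤ k}) ≤ (2/p_c³) · k · e_n`. -/
theorem census_real (n k : ℕ) :
    μ.real ({ω | (∃ y : Site 3, (n : ℤ) ≤ y 0 ∧ ω ∈ openConnIn (halfSpace 3) 0 y) ∧
            (∃ y : Site 3, (n : ℤ) ≤ y 0 ∧ ω ∈ openConnIn (halfSpace 3) ((0 : Site 3) + Pi.single 1 1) y) ∧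
            ω ∉ openConnIn (halfSpace 3) 0 ((0 : Site 3) + Pi.single 1 1)} ∩
          {ω | {q : Site 3 × Site 3 | q.1 0 = 0 ∧ q.2 0 = 0 ∧ (zdGraph 3).Adj q.1 q.2 ∧
              ω ∈ openConnIn (halfSpace 3) 0 q.1 ∧ ω ∉ openConnIn (halfSpace 3) 0 q.2 ∧
              ∃ y : Site 3, (n : ℤ) ≤ y 0 ∧ ω ∈ openConnIn (halfSpace 3) q.2 y}.ncard ≤ k}) ≤
      2 / (criticalProbI 3 : ℝ) ^ 3 * (k : ℝ) * (eD n).toReal := by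
  have hp : 0 < (criticalProbI 3 : ℝ) := by
    rw [coe_criticalProbI]
    exact (Grimmett1999_criticalProb_pos_lt_one_holds 3 (by norm_num)).1
  have hp3 : 0 < (criticalProbI 3 : ℝ) ^ 3 := pow_pos hp 3
  have hfin : (2 * k * eD n) / ENNReal.ofReal ((criticalProbI 3 : ℝ) ^ 3) ≠ ⊤ :=
    (ENNReal.div_lt_top (ENNReal.mul_ne_top (ENNReal.mul_ne_top ENNReal.ofNat_ne_top (ENNReal.natCast_ne_top k))
      (eD_ne_top n)) (ENNReal.ofReal_pos.2 hp3).ne').ne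
  rw [measureReal_def]
  calc _ ≤ ((2 * k * eD n) / ENNReal.ofReal ((criticalProbI 3 : ℝ) ^ 3)).toReal :=
        ENNReal.toReal_mono hfin (census_ennreal n k)
    _ = 2 / (criticalProbI 3 : ℝ) ^ 3 * (k : ℝ) * (eD n).toReal := by
        rw [ENNReal.toReal_div, ENNReal.toReal_mul, ENNReal.toReal_mul, ENNReal.toReal_ofReal hp3.le,
          ENNReal.toReal_ofNat, ENNReal.toReal_natCast]
        field_simp

end StubCensus

/-- **Registered stub `stub_census`** of the skeleton `Cruxes/BoundaryTwoArmDecay/Lines/staircase_bootstrap_floor_decoupling.lean`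
(line `staircase-bootstrap-floor-decoupling`): the TRUNCATED LEVEL CENSUS `P(A_n ∧ K_n ≤ k) ≤ C·k·e_n` for all `n, k`
(with `C = 2/p_c(ℤ³)³`; the guards `1 ≤ n`, `1 ≤ k` are not needed). Proof: the root transport
(`stub_census_rootTransport`: `P(A_n ∧ K_n ≤ k) ≤ k κ_n`), the staple (`kap_le_X`: `p_c³ κ_n ≤ X_n`) and the level
census (`X_le_two_eD`: `X_n ≤ 2 e_n`, from the two-anchor transport, vertical stationarity and BGN finiteness). -/
theorem stub_census :
    ∃ C : ℝ, ∀ n k : ℕ, 1 ≤ n → 1 ≤ k →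
      (bondPercolation (zdGraph 3) (criticalProbI 3)).real
          ({ω | (∃ y : Site 3, (n : ℤ) ≤ y 0 ∧ ω ∈ openConnIn (halfSpace 3) 0 y) ∧
              (∃ y : Site 3, (n : ℤ) ≤ y 0 ∧ ω ∈ openConnIn (halfSpace 3) ((0 : Site 3) + Pi.single 1 1) y) ∧
              ω ∉ openConnIn (halfSpace 3) 0 ((0 : Site 3) + Pi.single 1 1)} ∩
            {ω | {q : Site 3 × Site 3 | q.1 0 = 0 ∧ q.2 0 = 0 ∧ (zdGraph 3).Adj q.1 q.2 ∧
                ω ∈ openConnIn (halfSpace 3) 0 q.1 ∧ ω ∉ openConnIn (halfSpace 3) 0 q.2 ∧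
                ∃ y : Site 3, (n : ℤ) ≤ y 0 ∧ ω ∈ openConnIn (halfSpace 3) q.2 y}.ncard ≤ k}) ≤
        C * (k : ℝ) *
          (∫⁻ ω, {ω | (∃ y : Site 3, (n : ℤ) ≤ y 0 ∧ ω ∈ openConnIn (halfSpace 3) 0 y) ∧
                ¬ (∃ y : Site 3, ((n + 1 : ℕ) : ℤ) ≤ y 0 ∧ ω ∈ openConnIn (halfSpace 3) 0 y)}.indicator
              (fun ω => (((halfSpaceFootprint ω : ℕ∞) : ENNReal))⁻¹) ω
              ∂(bondPercolation (zdGraph 3) (criticalProbI 3))).toReal :=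
  ⟨2 / (criticalProbI 3 : ℝ) ^ 3, fun n k _ _ => StubCensus.census_real n k⟩

end Summit.CriticalPhenomena.PercolationContinuityZ3.Theorems.BoundaryTwoArmDecay

end
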